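/-
Copyright (c) 2026 the pub-hodgecm-mathlib formalisation cell (harness21).  Prover seat hodgecm-mathlib-K2Liu-p05 (g3), 2026-09-04
(Track B «K2-LIT», crux hLiu418 = stmt-HodgeConjecture-24832, socket #42F′, ROAD I v3, organ G2-Weil, bridge (G2-W4) part W4-i (frame half):
the archimedean metaplectic section of ONE adelic unitary group, at ONE real place, is a block pair — the five inputs of the factorisation).
-/
import Literature.NumberTheory.Weil1964.ArchUnitaryWeilHalf                          -- ★ `archWeilSectionS`, `archUFormPi`, `coe_proj_archWeilSectionS`
import Literature.NumberTheory.Weil1964.ArchFollandDualPairDefinitePlaceSlice         -- ★ `toUFormEquiv`, `wOf_injective`, `archUForm_adelicSingle`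
import Literature.NumberTheory.Weil1964.ArchPlacePhaseHomBlock                        -- ★ `placeSplitEquiv`, `coe_reindexSp_piPhaseHom_comp_section`
import Literature.NumberTheory.Weil1964.ArchWeilDatumFactorisationTransport           -- ★ `IsArchWeilDatum.exists_circle_twist_factorisation`
import Literature.NumberTheory.Weil1964.ArchWeilDatumReindex                          -- ★ `IsArchWeilDatum.reindex`
import HarnessLib

/-!
# (G2-W4-i, frame half) The archimedean section `s_∞` of ONE adelic unitary group at ONE real place `σ` is a BLOCK PAIR:
# the one-place section `placeSec σ : U(P_σ,Q_σ) →* U(J)(F ⊗ ℝ)` and the five inputs `hW hc s hs_cont hs` of the factorisation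

Track B ∕ K2-LIT, hLiu418 = stmt-HodgeConjecture-24832, #42F′ ROAD I v3 organ G2-Weil, bridge (G2-W4) «`doubledWeilRep` at a real place» (LEAD F0P6-plan
(g12) RULING M-156j (3): «W4-i wants the `H_σ`-side one-place section (★ `archSingle`-type) … for a GENERAL arch `g`»).  Namespace
`Summit.HodgeConjecture.HodgeConjecture.Cruxes.HLiu418.K2LiuArchSectionPlaceBlock`.  ONE definition with body (`placeSec`, the one-place section in the
canonical sign frame) and proved theorems; no instance, no notation, no named fact, no `sorry`.  `--supports stmt-HodgeConjecture-24832 --as helper`.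

SETTING (★ `Weil1964/ArchUnitaryWeilHalf` §3, verbatim): a CM-type quadratic extension `E/F` (`c` the conjugation, fixing every infinite place:
`hfix`), a DIAGONAL non-degenerate hermitian form `J = diag(t₀) ⊗ 1` of rank `N`, the canonical sign frames `ε_v = signSplit x_v` of the real places
(`x_v = signVec wOf t₀ δ v`), and Folland's `det^{1/2}`-normalised section **`archWeilSectionS : U(J)(F ⊗ ℝ) →* Mp^𝓢(ℝ^{Fin N × places})`**
`= MpS.reindex archIdx ∘ weilHomV (Σ_v P_v) (Σ_v Q_v) 1 ∅ ∘ placeDiag ∘ archUFormPi`.  For the DOUBLED group of #42F′ (`J = hermD`, `N = n + n = 4`,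
`U(P_σ,Q_σ) ≅ U(2,2)` at every real `σ`) this is the section behind ★ `archHalfOf t = archWeilHalfD ⊗ η_t` (★ `K2LiuDoubledWeilRepArchPinned.omega_sD_archToAdelic_tmul`:
`ω(sD (k, 1_f))(a ⊗ f) = η_t(k) • ((frame conj of (archWeilSectionS k).1.2) a) ⊗ f`); everything below is stated for a GENERAL `(E, c, N, J)` and instantiates
there with `(J := hermD …) rfl` exactly as in that wrapper.

CONTENT — the doubled∕single-group twin of ★ `HodgeCM/Model/HypCensus/ArchDatumBlockAt` (which does the same for the PAIR datum `U(J_V) × U(J_W)`):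
* §1 **`placeSec σ : UForm (PosIdx x_σ) (NegIdx x_σ) →* UnitaryGroup.arch F E c N J`** — `g ↦ archSingle (wOf σ) (toUFormEquiv⁻¹ g)`: the element with
  sign-frame component `g` at `σ` and `1` at every other real place; `continuous_placeSec`; **`archUFormPi_placeSec : archUFormPi (placeSec σ g) =
  Pi.mulSingle σ g`** (★ `archUForm_adelicSingle`, ★ `archAt_archSingle_of_ne`, `wOf` injective);
* §2 **`proj_archWeilSectionS_eq_piPhaseHom`** — the phase homomorphism of `s_∞` IS the slice-by-slice homomorphism
  `(piPhaseHom ε (v ↦ UForm.toSp)) ∘ archUFormPi` (★ `coe_proj_archWeilSectionS`, as an identity of homomorphisms into `Sp`); hence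
  **`coe_proj_archWeilSectionS_placeSec`** — `hs`: in the split frame `(P_σ ⊕ Q_σ) ⊕ (Fin N × {v ≠ σ})` (★ `placeSplitEquiv`) the element
  `placeSec σ g` acts by `blockPhase ⇑(toSp g) id` (★ `coe_reindexSp_piPhaseHom_comp_section`);
* §3 **`isArchWeilDatum_toEnd_comp`** — ANY homomorphism `s : G →* Mp^𝓢` with continuous orbit maps is an archimedean Weil datum over `proj ∘ s`
  (★ `MpS.mem_iff_covariant`); so **`isArchWeilDatum_archSection`** (`hW` for `s_∞`, ★ `continuous_archWeilSectionS_apply`), **`isArchWeilDatum_archSectionAt`**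
  (the same read in the split frame at `σ`, ★ `IsArchWeilDatum.reindex`) and `hc` (`continuous_archSectionAt_apply`); and the SMALL datum
  **`isArchWeilDatum_weilRepV_toSp`**: `weilRepV P Q 1 ∅` relabelled by ★ `unitJunctionIdx` is a datum over `UForm.toSp P Q` (hypothesis-free, ★
  `isArchWeilDatum_weilRepV`);
* §4 **`exists_circle_twist_factorisation_placeSec`** — THE BRIDGE AT PRODUCT VECTORS: there is a continuous character `χ : U(P_σ,Q_σ) →* 𝕊¹` with
  `s_∞(placeSec σ u) (Φ₁ ⊠ Φ₂) = ((χ ⊗ ω₁) u Φ₁) ⊠ Φ₂` in the split frame, `ω₁ = weilRepV P_σ Q_σ 1 ∅` relabelled — Folland's section of the whole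
  archimedean group, at an element supported at `σ`, acts on the `σ`-variables by the junction Weil representation of `U(P_σ,Q_σ) × U(1,0)` up to a
  continuous character (★ `IsArchWeilDatum.exists_circle_twist_factorisation`).
What is NOT here (W4-i letters ∕ W4-ii, successor files): relabelling `P_σ ⊕ Q_σ ≃ Fin 2 ⊕ Fin 2` for `hermD`, pinning `χ` (trivial on boosts by ★
`weilDatum_apply_hypV_eq_hypOp` on both sides, a `det`-power on `K`), and the derivative `hasDerivAt_swSection_arch_orbit` through ★
`omega_sD_archToAdelic_tmul` + ★ `K2LiuWeilDatumTwistSmoothU22.contDiffAt_of_tensorPi_factorisation` + ★ `K2LiuWeilRepPairSmoothU22`.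

HONEST LABEL: HC_CM is proved only modulo the 7 printed citations (2 remaining named inputs: hLiu418 = stmt-HodgeConjecture-24832, h413 =
stmt-HodgeConjecture-24833) until rung 0 closes; organ capital for #42F′'s Road I, moves no counter.

## References
* [Weil1964] A. Weil, *Sur certains groupes d'opérateurs unitaires*, Acta Math. 111 (1964), Chap. I n° 12 p. 160, Chap. III n° 37–38.
* [Folland1989] G. B. Folland, *Harmonic Analysis in Phase Space* (1989), Prop. (1.43), §4.2 (4.23), Prop. (4.27), Prop. (4.39).
* [BorelJacquet1979] A. Borel, H. Jacquet, Proc. Symp. Pure Math. 33.1 (1979), §4.1.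
* [GelbartRogawski1991] S. Gelbart, J. Rogawski, Invent. Math. 105 (1991), §3.1 p. 454.
-/

set_option autoImplicit false
set_option linter.dupNamespace false

noncomputable section

open scoped Matrix Classical
open MeasureTheory
open NumberField NumberField.InfinitePlace NumberField.mixedEmbedding
open Literature.NumberTheory.Automorphic Literature.NumberTheory.Automorphic.UnitaryGroup
open Literature.RepresentationTheory.HeisenbergGroup Literature.Analysis.SegalBargmann
open Literature.RepresentationTheory.KonnoKonno2007 Literature.RepresentationTheory.KonnoKonno2007.RealDualPair
open Literature.NumberTheory.Weil1964 Literature.NumberTheory.Weil1964.MpS Literature.NumberTheory.Weil1964.UnitaryWeil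

namespace Summit.HodgeConjecture.HodgeConjecture.Cruxes.HLiu418.K2LiuArchSectionPlaceBlock

/-! ## §3a Generic: a homomorphism into `Mp^𝓢` with continuous orbits is an archimedean Weil datum over its projection -/

section Generic

variable {τ : Type} [Fintype τ] [DecidableEq τ] {G : Type*} [Group G] [TopologicalSpace G]

/-- **any `s : G →* Mp^𝓢(ℝ^τ)` with continuous orbit maps is an archimedean Weil datum over `proj ∘ s`**: (w2) covariance and (w2′) unitary
lifts are the MEMBERSHIP conditions of `Mp^𝓢` (★ `MpS.mem_iff_covariant`). [cite: Folland1989, §4.2 (4.23), Prop. (4.27)] -/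
theorem isArchWeilDatum_toEnd_comp (s : G →* MpS τ) (hs : ∀ f : SchwartzMap (τ → ℝ) ℂ, Continuous fun g => (s g).1.2 f) :
    IsArchWeilDatum (MpS.proj.comp s) (MpS.toEnd.comp s) where
  continuous_apply f := hs f
  covariant g p q f := ((MpS.mem_iff_covariant _).1 (s g).2).1 p q f
  exists_lift g := ((MpS.mem_iff_covariant _).1 (s g).2).2

omit [TopologicalSpace G] in
/-- the operators of `toEnd ∘ s` are continuous (they are topological automorphisms of `𝓢`). [cite: Folland1989, §4.2 (4.23)] -/
theorem continuous_toEnd_comp_apply (s : G →* MpS τ) (g : G) : Continuous (MpS.toEnd.comp s g) :=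
  (s g).1.2.continuous

end Generic

/-! ## §3b Generic: the junction Weil representation of `U(P,Q) × U(1,0)` relabelled to `P ⊕ Q` is a datum over `UForm.toSp` -/

section Small

variable (P Q : Type) [Fintype P] [DecidableEq P] [Fintype Q] [DecidableEq Q]

/-- **`ι𝕎 (g, 1)` relabelled by `unitJunctionIdx` is `toSp g`** (★ `coe_proj_weilHomV_unit`), as an identity of homomorphisms into `Sp(ℝ^{P ⊕ Q})`.
[cite: KonnoKonno2007, §3.1 (3.1)] [cite: Weil1964, Chap. I n° 12 p. 160] -/
theorem reindexSp_unitJunctionIdx_comp_ι𝕎_inl :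
    (reindexSp (unitJunctionIdx P Q)).comp ((ι𝕎 P Q Unit Empty).comp (MonoidHom.inl (UForm P Q) (UForm Unit Empty))) =
      UForm.toSp P Q := by
  refine MonoidHom.ext fun g => Subtype.ext (LinearEquiv.ext fun pq => ?_)
  have h := congrFun (coe_proj_weilHomV_unit (α := P) (β := Q) g) ((reindexPV (unitJunctionIdx P Q)).symm pq)
  rw [proj_weilHomV] at h
  show reindexPV (unitJunctionIdx P Q) (((ι𝕎 P Q Unit Empty (g, 1)).1 :
      ((DPIdx P Q Unit Empty → ℝ) × (DPIdx P Q Unit Empty → ℝ)) ≃ₗ[ℝ] ((DPIdx P Q Unit Empty → ℝ) × (DPIdx P Q Unit Empty → ℝ)))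
      ((reindexPV (unitJunctionIdx P Q)).symm pq)) = _
  rw [h, UForm.coe_toSp]
  show reindexPhase (unitJunctionIdx P Q) (reindexPhase (unitJunctionIdx P Q).symm
      (twRealify ((g : GL (P ⊕ Q) ℂ) : Matrix (P ⊕ Q) (P ⊕ Q) ℂ))) pq = _
  rw [reindexPhase_reindexPhase, Equiv.self_trans_symm]
  rfl

/-- **the SMALL datum**: `weilRepV P Q 1 ∅` relabelled to `𝓢(ℝ^{P ⊕ Q})` is an archimedean Weil datum over `UForm.toSp P Q` — hypothesis-free
(★ `isArchWeilDatum_weilRepV` + ★ `IsArchWeilDatum.reindex`). [cite: Folland1989, §4.2 (4.23), Prop. (4.39)] [cite: KonnoKonno2007, §3.3] -/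
theorem isArchWeilDatum_weilRepV_toSp :
    IsArchWeilDatum (UForm.toSp P Q) (repTransport (reindexCLE (unitJunctionIdx P Q)) (weilRepV P Q Unit Empty)) := by
  rw [← reindexSp_unitJunctionIdx_comp_ι𝕎_inl]
  exact (isArchWeilDatum_weilRepV P Q Unit Empty).reindex (unitJunctionIdx P Q)

/-- its operators are continuous. [cite: Folland1989, §4.2 (4.23)] -/
theorem continuous_repTransport_weilRepV (g : UForm P Q) :
    Continuous (repTransport (reindexCLE (unitJunctionIdx P Q)) (weilRepV P Q Unit Empty) g) :=
  continuous_repTransport_reindexCLE _ (fun g => (weilHomV P Q Unit Empty g).1.2.continuous) g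

end Small

/-! ## §1 The one-place section `placeSec σ` in the canonical sign frame -/

section Place

variable {F : Type} [Field F] [NumberField F] (E : Type) [Field E] [NumberField E] [Algebra F E] (c : E ≃ₐ[F] E)
  (N : ℕ) (hc : c ≠ 1)
  (wOf : {v : InfinitePlace F // v.IsReal} → {w : InfinitePlace E // w.IsComplex})
  (hw : ∀ v, c • (wOf v).1 = (wOf v).1) (t₀ : Fin N → F) (ht0 : ∀ j, t₀ j ≠ 0) {δ : E} (hcδ : c δ = -δ) (hδ : δ ≠ 0)
  (σ : {v : InfinitePlace F // v.IsReal})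

/-- **the Sylvester identity of the canonical sign frame at `σ`**: `diag(D_σ)ᴴ (c_σ • diag(1,−1))^{ε_σ} diag(D_σ) = σ_{w(σ)}(J)`, i.e. the local form
`J ⊗_{w(σ)} ℂ` IS the scaled sign form (`D_σ = √|x_σ|`, `c_σ = im σ_{w(σ)}(δ)`; ★ `formCongr_scaleGL_smul_signForm` + ★ `archLocalForm_diagonal`).
[cite: BorelJacquet1979, §4.1] [cite: Folland1989, Ch. 4 §1 Prop. (4.6)] -/
theorem formCongr_signFrame_eq (hover : ∀ v, (wOf v).1.comap (algebraMap F E) = v.1) {T : Matrix (Fin N) (Fin N) F}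
    (hTd : T = Matrix.diagonal t₀) {J : Matrix (Fin N) (Fin N) E} (hJ : J = T.map (algebraMap F E)) :
    formCongr (starRingEnd ℂ) (scaleGL (sqrtAbs (signVec wOf t₀ δ σ)) (sqrtAbs_signVec_ne_zero hc hw hcδ hδ ht0 σ))
        ((((deltaIm wOf δ σ : ℝ) : ℂ) • signForm (PosIdx (signVec wOf t₀ δ σ)) (NegIdx (signVec wOf t₀ δ σ))).submatrix
          (signSplit (signVec wOf t₀ δ σ)) (signSplit (signVec wOf t₀ δ σ))) =
      J.map (wOf σ).1.embedding :=
  (formCongr_scaleGL_smul_signForm (signSplit (signVec wOf t₀ δ σ)) (sqrtAbs_signVec_ne_zero hc hw hcδ hδ ht0 σ)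
      (deltaIm wOf δ σ) (ht_signVec hc hw hcδ hδ ht0 σ)).trans
    (archLocalForm_diagonal E c N hc wOf hw hover t₀ (hJ_diagonal E N t₀ hTd hJ) σ).symm

variable (hover : ∀ v, (wOf v).1.comap (algebraMap F E) = v.1) {T : Matrix (Fin N) (Fin N) F} (hTd : T = Matrix.diagonal t₀)
  {J : Matrix (Fin N) (Fin N) E} (hJ : J = T.map (algebraMap F E)) (hfix : ∀ w : InfinitePlace E, c • w = w)

/-- **`placeSec σ : U(P_σ,Q_σ) →* U(J)(F ⊗ ℝ)`**, `g ↦ archSingle (wOf σ) (toUFormEquiv⁻¹ g)`: the archimedean element with sign-frame component `g` at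
the real place `σ` and `1` at every other real place (★ `UnitaryGroup.archSingle`, ★ `toUFormEquiv`). [cite: BorelJacquet1979, §4.1] -/
def placeSec : UForm (PosIdx (signVec wOf t₀ δ σ)) (NegIdx (signVec wOf t₀ δ σ)) →* UnitaryGroup.arch F E c N J :=
  (UnitaryGroup.archSingle F E c N J hc hfix (wOf σ)).comp
    (toUFormEquiv (signSplit (signVec wOf t₀ δ σ)) (sqrtAbs_signVec_ne_zero hc hw hcδ hδ ht0 σ) (deltaIm_ne_zero hc hw hcδ hδ σ)
      (formCongr_signFrame_eq E c N hc wOf hw t₀ ht0 hcδ hδ σ hover hTd hJ)).symm.toMulEquiv.toMonoidHom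

/-- Unfolding. [cite: BorelJacquet1979, §4.1] -/
theorem placeSec_apply (g : UForm (PosIdx (signVec wOf t₀ δ σ)) (NegIdx (signVec wOf t₀ δ σ))) :
    placeSec E c N hc wOf hw t₀ ht0 hcδ hδ σ hover hTd hJ hfix g =
      UnitaryGroup.archSingle F E c N J hc hfix (wOf σ)
        ((toUFormEquiv (signSplit (signVec wOf t₀ δ σ)) (sqrtAbs_signVec_ne_zero hc hw hcδ hδ ht0 σ) (deltaIm_ne_zero hc hw hcδ hδ σ)
          (formCongr_signFrame_eq E c N hc wOf hw t₀ ht0 hcδ hδ σ hover hTd hJ)).symm g) := rfl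

/-- `placeSec σ` is continuous. [cite: BorelJacquet1979, §4.1] -/
theorem continuous_placeSec : Continuous (placeSec E c N hc wOf hw t₀ ht0 hcδ hδ σ hover hTd hJ hfix) :=
  (UnitaryGroup.continuous_archSingle F E c N J hc hfix (wOf σ)).comp
    (continuous_toUFormEquiv_symm (signSplit (signVec wOf t₀ δ σ)) (sqrtAbs_signVec_ne_zero hc hw hcδ hδ ht0 σ)
      (deltaIm_ne_zero hc hw hcδ hδ σ) (formCongr_signFrame_eq E c N hc wOf hw t₀ ht0 hcδ hδ σ hover hTd hJ))

/-- **at its own place the section IS `g`**: `archUFormPi (placeSec σ g) σ = g` (★ `archUForm_adelicSingle`, ★ `toUForm_toUFormEquiv_symm`).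
[cite: BorelJacquet1979, §4.1] -/
theorem archUFormPi_placeSec_self (g : UForm (PosIdx (signVec wOf t₀ δ σ)) (NegIdx (signVec wOf t₀ δ σ))) :
    archUFormPi E c N hc wOf hw hover t₀ ht0 hTd hJ hcδ hδ (placeSec E c N hc wOf hw t₀ ht0 hcδ hδ σ hover hTd hJ hfix g) σ = g := by
  rw [archUFormPi_apply, placeSec_apply]
  exact (archUForm_adelicSingle E c N hc wOf hw hover t₀ (hJ_diagonal E N t₀ hTd hJ) σ (signSplit (signVec wOf t₀ δ σ))
      (sqrtAbs_signVec_ne_zero hc hw hcδ hδ ht0 σ) (deltaIm_ne_zero hc hw hcδ hδ σ) (ht_signVec hc hw hcδ hδ ht0 σ) hfix _).trans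
    (toUForm_toUFormEquiv_symm _ _ _ _ g)

/-- **at every other real place the section is `1`**: `archUFormPi (placeSec σ g) v = 1` for `v ≠ σ` (★ `archAt_archSingle_of_ne`; `wOf` is injective by
`hover`). [cite: BorelJacquet1979, §4.1] -/
theorem archUFormPi_placeSec_of_ne {v : {v : InfinitePlace F // v.IsReal}} (hv : v ≠ σ)
    (g : UForm (PosIdx (signVec wOf t₀ δ σ)) (NegIdx (signVec wOf t₀ δ σ))) :
    archUFormPi E c N hc wOf hw hover t₀ ht0 hTd hJ hcδ hδ (placeSec E c N hc wOf hw t₀ ht0 hcδ hδ σ hover hTd hJ hfix g) v = 1 := by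
  have hne : wOf v ≠ wOf σ := fun h' => hv (wOf_injective hover h')
  rw [archUFormPi_apply, placeSec_apply]
  -- `archUForm v` reads the `wOf v`-component, which is `1`
  show toUForm (signSplit (signVec wOf t₀ δ v)) (sqrtAbs_signVec_ne_zero hc hw hcδ hδ ht0 v) (deltaIm_ne_zero hc hw hcδ hδ v) _
      (archAt F E c N J (wOf v) (hw v) hc (archPart F E c N J (UnitaryGroup.archToAdelic F E c N J
        (UnitaryGroup.archSingle F E c N J hc hfix (wOf σ) _)))) = 1
  rw [archPart_archToAdelic, archAt_archSingle_of_ne F E c N J hc hfix (wOf σ) hne]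
  exact map_one _

/-- **`archUFormPi (placeSec σ g) = Pi.mulSingle σ g`** — the hypothesis `hsec` of ★ `coe_reindexSp_piPhaseHom_comp_section`. [cite: BorelJacquet1979, §4.1] -/
theorem archUFormPi_placeSec (g : UForm (PosIdx (signVec wOf t₀ δ σ)) (NegIdx (signVec wOf t₀ δ σ))) :
    archUFormPi E c N hc wOf hw hover t₀ ht0 hTd hJ hcδ hδ (placeSec E c N hc wOf hw t₀ ht0 hcδ hδ σ hover hTd hJ hfix g) = Pi.mulSingle σ g := by
  funext v
  by_cases hv : v = σ
  · subst hv
    rw [Pi.mulSingle_eq_same, archUFormPi_placeSec_self]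
  · rw [Pi.mulSingle_eq_of_ne hv, archUFormPi_placeSec_of_ne E c N hc wOf hw t₀ ht0 hcδ hδ σ hover hTd hJ hfix hv]

/-! ## §2 The phase homomorphism of `s_∞` is slice-by-slice; at `placeSec σ g` it is a block -/

/-- **the phase homomorphism of `s_∞` IS `(piPhaseHom ε toSp) ∘ archUFormPi`** (★ `coe_proj_archWeilSectionS`, ★ `coe_piPhaseHom`, ★ `UForm.coe_toSp`),
as an identity of homomorphisms `U(J)(F ⊗ ℝ) →* Sp(ℝ^{Fin N × places})`. [cite: Weil1964, Chap. I n° 12 p. 160, Chap. III n° 37] [cite: KonnoKonno2007, §3.1 (3.1)] -/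
theorem proj_comp_archWeilSectionS_eq_piPhaseHom :
    MpS.proj.comp (archWeilSectionS E c N hc wOf hw hover t₀ ht0 hTd hJ hcδ hδ) =
      (piPhaseHom (fun v => signSplit (signVec wOf t₀ δ v))
          (fun v => UForm.toSp (PosIdx (signVec wOf t₀ δ v)) (NegIdx (signVec wOf t₀ δ v)))).comp
        (archUFormPi E c N hc wOf hw hover t₀ ht0 hTd hJ hcδ hδ) := by
  refine MonoidHom.ext fun g => Subtype.ext (LinearEquiv.ext fun pq => ?_)
  have h := congrFun (coe_proj_archWeilSectionS E c N hc wOf hw hover t₀ ht0 hTd hJ hcδ hδ g) pq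
  rw [MonoidHom.comp_apply, MonoidHom.comp_apply]
  exact h

/-- **`hs` — AT `placeSec σ g` THE SECTION ACTS, IN THE SPLIT FRAME OF `σ`, BY THE BLOCK `blockPhase ⇑(toSp g) id`** (★ `coe_reindexSp_piPhaseHom_comp_section`
with `ϖ = archUFormPi`, `sec = placeSec σ`, `hsec = archUFormPi_placeSec`). [cite: Weil1964, Chap. I n° 12 p. 160] [cite: Folland1989, Prop. (1.43)] -/
theorem coe_proj_archWeilSectionS_placeSec (g : UForm (PosIdx (signVec wOf t₀ δ σ)) (NegIdx (signVec wOf t₀ δ σ))) :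
    (⇑((((reindexSp (placeSplitEquiv (signSplit (signVec wOf t₀ δ σ)) σ)).comp
          (MpS.proj.comp (archWeilSectionS E c N hc wOf hw hover t₀ ht0 hTd hJ hcδ hδ)))
          (placeSec E c N hc wOf hw t₀ ht0 hcδ hδ σ hover hTd hJ hfix g)).1 :
        (((PosIdx (signVec wOf t₀ δ σ) ⊕ NegIdx (signVec wOf t₀ δ σ)) ⊕ (Fin N × {v : {v : InfinitePlace F // v.IsReal} // v ≠ σ}) → ℝ) × ((PosIdx (signVec wOf t₀ δ σ) ⊕ NegIdx (signVec wOf t₀ δ σ)) ⊕ (Fin N × {v : {v : InfinitePlace F // v.IsReal} // v ≠ σ}) → ℝ)) ≃ₗ[ℝ]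
          (((PosIdx (signVec wOf t₀ δ σ) ⊕ NegIdx (signVec wOf t₀ δ σ)) ⊕ (Fin N × {v : {v : InfinitePlace F // v.IsReal} // v ≠ σ}) → ℝ) × ((PosIdx (signVec wOf t₀ δ σ) ⊕ NegIdx (signVec wOf t₀ δ σ)) ⊕ (Fin N × {v : {v : InfinitePlace F // v.IsReal} // v ≠ σ}) → ℝ))) :
        PhaseMap ((PosIdx (signVec wOf t₀ δ σ) ⊕ NegIdx (signVec wOf t₀ δ σ)) ⊕ (Fin N × {v : {v : InfinitePlace F // v.IsReal} // v ≠ σ}))) =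
      blockPhase
        (⇑((UForm.toSp (PosIdx (signVec wOf t₀ δ σ)) (NegIdx (signVec wOf t₀ δ σ)) g).1 :
          ((PosIdx (signVec wOf t₀ δ σ) ⊕ NegIdx (signVec wOf t₀ δ σ) → ℝ) × (PosIdx (signVec wOf t₀ δ σ) ⊕ NegIdx (signVec wOf t₀ δ σ) → ℝ)) ≃ₗ[ℝ] ((PosIdx (signVec wOf t₀ δ σ) ⊕ NegIdx (signVec wOf t₀ δ σ) → ℝ) × (PosIdx (signVec wOf t₀ δ σ) ⊕ NegIdx (signVec wOf t₀ δ σ) → ℝ))))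
        id := by
  rw [proj_comp_archWeilSectionS_eq_piPhaseHom]
  exact coe_reindexSp_piPhaseHom_comp_section (fun v => signSplit (signVec wOf t₀ δ v))
    (fun v => UForm.toSp (PosIdx (signVec wOf t₀ δ v)) (NegIdx (signVec wOf t₀ δ v))) σ
    (archUFormPi E c N hc wOf hw hover t₀ ht0 hTd hJ hcδ hδ) (placeSec E c N hc wOf hw t₀ ht0 hcδ hδ σ hover hTd hJ hfix)
    (archUFormPi_placeSec E c N hc wOf hw t₀ ht0 hcδ hδ σ hover hTd hJ hfix) g

/-! ## §3 The big datum `s_∞` (`hW`, `hc`), as is and in the split frame at `σ` -/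

/-- **`hW` for `s_∞`**: `toEnd ∘ archWeilSectionS` is an archimedean Weil datum over `proj ∘ archWeilSectionS` (★ `continuous_archWeilSectionS_apply` + §3a).
[cite: Folland1989, §4.2 (4.23), Prop. (4.27)] [cite: Weil1964, Chap. III n° 38] -/
theorem isArchWeilDatum_archSection :
    IsArchWeilDatum (MpS.proj.comp (archWeilSectionS E c N hc wOf hw hover t₀ ht0 hTd hJ hcδ hδ))
      (MpS.toEnd.comp (archWeilSectionS E c N hc wOf hw hover t₀ ht0 hTd hJ hcδ hδ)) :=
  isArchWeilDatum_toEnd_comp _ (continuous_archWeilSectionS_apply E c N hc wOf hw hover t₀ ht0 hTd hJ hcδ hδ)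

/-- **`hW` in the split frame at `σ`**: the datum `s_∞` read on `𝓢(ℝ^{(P_σ ⊕ Q_σ) ⊕ (Fin N × {v ≠ σ})})` is an archimedean Weil datum over
`reindexSp (placeSplitEquiv ε_σ σ) ∘ proj ∘ archWeilSectionS` (★ `IsArchWeilDatum.reindex`). [cite: Weil1964, Chap. I n° 12 p. 160] [cite: Folland1989, §1.3 (1.25), §4.2 (4.23)] -/
theorem isArchWeilDatum_archSectionAt :
    IsArchWeilDatum
      ((reindexSp (placeSplitEquiv (signSplit (signVec wOf t₀ δ σ)) σ)).comp
        (MpS.proj.comp (archWeilSectionS E c N hc wOf hw hover t₀ ht0 hTd hJ hcδ hδ)))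
      (repTransport (reindexCLE (placeSplitEquiv (signSplit (signVec wOf t₀ δ σ)) σ))
        (MpS.toEnd.comp (archWeilSectionS E c N hc wOf hw hover t₀ ht0 hTd hJ hcδ hδ))) :=
  (isArchWeilDatum_archSection E c N hc wOf hw t₀ ht0 hcδ hδ hover hTd hJ).reindex _

/-- **`hc` in the split frame**: every operator of the split-frame datum is continuous. [cite: Folland1989, §4.2 (4.23)] -/
theorem continuous_archSectionAt_apply (g : UnitaryGroup.arch F E c N J) :
    Continuous (repTransport (reindexCLE (placeSplitEquiv (signSplit (signVec wOf t₀ δ σ)) σ))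
      (MpS.toEnd.comp (archWeilSectionS E c N hc wOf hw hover t₀ ht0 hTd hJ hcδ hδ)) g) :=
  continuous_repTransport_reindexCLE _ (continuous_toEnd_comp_apply (archWeilSectionS E c N hc wOf hw hover t₀ ht0 hTd hJ hcδ hδ)) g

/-! ## §4 The factorisation at product vectors along `placeSec σ` -/

/-- **THE ARCHIMEDEAN SECTION AT AN ELEMENT SUPPORTED AT `σ` FACTORISES AT PRODUCT VECTORS**: there is a CONTINUOUS character
`χ : U(P_σ,Q_σ) →* 𝕊¹` such that for every `u ∈ U(P_σ,Q_σ)`, `Φ₁ ∈ 𝓢(ℝ^{P_σ ⊕ Q_σ})`, `Φ₂ ∈ 𝓢(ℝ^{Fin N × {v ≠ σ}})`: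
`s_∞ (placeSec σ u) (Φ₁ ⊠ Φ₂) = ((χ ⊗ ω₁) u Φ₁) ⊠ Φ₂` in the split frame, `ω₁ = weilRepV P_σ Q_σ 1 ∅` relabelled to `P_σ ⊕ Q_σ` — the `σ`-variables
move by the junction Weil representation of `U(P_σ,Q_σ) × U(1,0)` up to a character, the other variables do not move
(★ `IsArchWeilDatum.exists_circle_twist_factorisation` on §1–§3). [cite: Folland1989, Prop. (1.43), §4.2 (4.23)] [cite: Weil1964, Chap. III n° 37–38] -/
theorem exists_circle_twist_factorisation_placeSec :
    ∃ χ : UForm (PosIdx (signVec wOf t₀ δ σ)) (NegIdx (signVec wOf t₀ δ σ)) →* Circle, Continuous χ ∧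
      ∀ (u : UForm (PosIdx (signVec wOf t₀ δ σ)) (NegIdx (signVec wOf t₀ δ σ)))
        (Φ₁ : SchwartzMap ((PosIdx (signVec wOf t₀ δ σ) ⊕ NegIdx (signVec wOf t₀ δ σ)) → ℝ) ℂ)
        (Φ₂ : SchwartzMap ((Fin N × {v : {v : InfinitePlace F // v.IsReal} // v ≠ σ}) → ℝ) ℂ),
        repTransport (reindexCLE (placeSplitEquiv (signSplit (signVec wOf t₀ δ σ)) σ))
            (MpS.toEnd.comp (archWeilSectionS E c N hc wOf hw hover t₀ ht0 hTd hJ hcδ hδ))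
            (placeSec E c N hc wOf hw t₀ ht0 hcδ hδ σ hover hTd hJ hfix u) (tensorPi Φ₁ Φ₂) =
          tensorPi (charTwist (Circle.coeHom.comp χ)
            (repTransport (reindexCLE (unitJunctionIdx (PosIdx (signVec wOf t₀ δ σ)) (NegIdx (signVec wOf t₀ δ σ))))
              (weilRepV (PosIdx (signVec wOf t₀ δ σ)) (NegIdx (signVec wOf t₀ δ σ)) Unit Empty)) u Φ₁) Φ₂ :=
  (isArchWeilDatum_archSectionAt E c N hc wOf hw t₀ ht0 hcδ hδ σ hover hTd hJ).exists_circle_twist_factorisation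
    (continuous_archSectionAt_apply E c N hc wOf hw t₀ ht0 hcδ hδ σ hover hTd hJ)
    (isArchWeilDatum_weilRepV_toSp (PosIdx (signVec wOf t₀ δ σ)) (NegIdx (signVec wOf t₀ δ σ)))
    (continuous_repTransport_weilRepV (PosIdx (signVec wOf t₀ δ σ)) (NegIdx (signVec wOf t₀ δ σ)))
    (placeSec E c N hc wOf hw t₀ ht0 hcδ hδ σ hover hTd hJ hfix) (continuous_placeSec E c N hc wOf hw t₀ ht0 hcδ hδ σ hover hTd hJ hfix)
    (coe_proj_archWeilSectionS_placeSec E c N hc wOf hw t₀ ht0 hcδ hδ σ hover hTd hJ hfix)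

end Place

end Summit.HodgeConjecture.HodgeConjecture.Cruxes.HLiu418.K2LiuArchSectionPlaceBlock

end
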